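import Literature.MathematicalPhysics.QuantumLattice.HubbardFerrimagneticOrder
import Literature.MathematicalPhysics.QuantumLattice.HubbardCanonicalSusceptibilityBounds
import HarnessLib

/-!
# Shen–Qiu: off-diagonal long-range order in the ground state of the attractive Hubbard model on
# an unbalanced bipartite graph (superconductivity from Lieb's ferrimagnetism by the Shiba map)

Topic `MathematicalPhysics/QuantumLattice` (family `hubbard`). Cell `pub/hubbard-cq`, seat
`hubbard-pc-lit-1` (transfer sources: a positive-order certificate for PAIRING in a fermionic
Hubbard model). HONEST FRAMING: a finite-volume KERNEL for the ATTRACTIVE (`U < 0`) Hubbard model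
at half filling with bipartite hopping (`t' = 0`); the order is `s`-wave on-site pairing with
ordering wave vector `0`, forced by the sublattice imbalance `|A| ≠ |B|` (Lieb lattices). Nothing is
claimed for the repulsive model, away from half filling, or for `|A| = |B|` (where the floor is `0`).

Goto–Koma–Yoshida (arXiv:2509.19780, Phys. Scr. 101 (2026) 325218, p. 1): "Shen and Qiu [PRL 71
(1993) 4238] proved the existence of superconducting long-range order in the ground state for certain
fillings of fermions in the case of the attractive interaction on the so-called Lieb lattices. To
the best of our knowledge, their result is the only known proof of superconductivity for the
spin-1/2 Hubbard model." This file formalises the canonical (fixed even particle number) statement,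
which is Goto–Koma–Yoshida's eq. (5.9) / Theorem 5.1 without the grand-canonical averaging factor
(their §5: "the proof of the long-range order bound in the even particle number sector is
essentially contained in the work of Shen and Qiu").

Setting: a finite connected graph `G` on an ordered site set `Λ`, bipartite with colour class `A`
(`B = Aᶜ`, any `|A|, |B|`), `|Λ|` even, hopping `t ≠ 0`, attraction `U < 0`, half filling
`N = |Λ|`; `S₀ = liebSpin A = ||A| - |B||/2`; on-site pairs `Δ†_x = c†_{x↑} c†_{x↓}`,
`Δ_y = c_{y↓} c_{y↑}`.

* `shibaGauge A`, `shiba A` — Lieb's / Kubo–Kishi's gauged partial particle–hole (Shiba)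
  transformation `S = orbitalPhase g · W_{D↓}`, `g(x↓) = ε_x = ±1` the sublattice sign, `g(x↑) = 1`
  (`c_{x↓} ↦ ε_x c†_{x↓}`, `c_{x↑} ↦ c_{x↑}`): unitary; `S H(t,U) Sᴴ = H(t,-U) + U N↑`
  (the tree's `shibaKK_conj_hamiltonian`); it maps the coordinate sector `(n, n)` onto itself
  (`|Λ| = 2n`) and the transverse spin flip to the pair hopping:
  `S (S⁺_x S⁻_y) Sᴴ = ε_x ε_y Δ†_x Δ_y` (`shiba_conj_spinPlus_mul_spinMinus`).
* **Positivity of the pair correlation** (`expect_pair_correlation_nonneg`): for every half-filled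
  ground state `ψ` of the attractive model, `⟨ψ, Δ†_x Δ_y ψ⟩ ≥ 0` for all `x, y` (Goto–Koma–Yoshida
  (3.14)/(5.5); here from the Shen–Qiu–Tian sign rule of the repulsive image,
  `LiebTwo.sector_sign_rule`).
* **Shen–Qiu's off-diagonal long-range order (kernel form)** (`liebSpin_le_re_expect_pairSum`,
  `sq_card_sub_le_re_expect_pairSum`, `…_eta`): for every half-filled ground state `ψ` of the
  attractive model (unique by Lieb's Theorem 1),
  `S₀(S₀+1) ‖ψ‖² ≤ Re ⟨ψ, (Σ_x Δ†_x)(Σ_y Δ_y) ψ⟩ = ‖(Σ_y Δ_y) ψ‖²`, hence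
  `¼(|A| - |B|)² ‖ψ‖² ≤ ⟨ψ, η₀† η₀ ψ⟩` with `η₀ = Σ_y c_{y↓} c_{y↑}` the zero-momentum pair
  annihilator: in Goto–Koma–Yoshida's normalisation `ω₀([O_super]† O_super) ≥ S₀(S₀+1)/|Λ|²`,
  `O_super = |Λ|⁻¹ Σ_x c_{x↓} c_{x↑}` — an `|Λ|`-independent positive floor on the `s`-wave pair
  structure factor per site² whenever `|A| - |B| ∝ |Λ|` (Lieb lattices, e.g. the `CuO₂` lattice with
  `|B| = 2|A|`: floor `→ 1/36`).

## The mechanism (Shiba transfer of Lieb's ferrimagnetism; a Lean proof following GKY §4–§5)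

Let `ψ` be a half-filled ground state of `H(t, U)`, `U < 0`. By Lieb's Theorem 1
(`lieb_attractive_holds`) `S² ψ = 0`, so `S^z ψ = 0` and `ψ` lies in the coordinate sector
`(n, n)`, `|Λ| = 2n`. Put `φ = Sᴴ ψ`: it lies in the sector `(n, n)` of the REPULSIVE model
`H(t, -U)`, is an eigenvector with eigenvalue `E₀(U) - U n`, and two variational inequalities
(`groundEnergy_le_re_expect` on the attractive side applied to `S Φ(W₀)`, the sector minimum on the
repulsive side applied to `φ`) show that this eigenvalue is the sector energy `E(n, n)` of
`H(t, -U)`; so `φ` is THE `(n, n)`-sector ground state of the repulsive model — a member of Lieb's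
spin-`S₀` ground multiplet (`S² φ = S₀(S₀+1) φ`, `S^z φ = 0`) obeying the Shen–Qiu–Tian sign rule
`ε_x ε_y ⟨φ, S⁺_x S⁻_y φ⟩ ≥ 0` (`HubbardFerrimagneticOrder`). Then
`⟨ψ, Δ†_x Δ_y ψ⟩ = ε_x ε_y ⟨φ, S⁺_x S⁻_y φ⟩ ≥ 0`, and summing,
`Σ_{x,y} ⟨ψ, Δ†_x Δ_y ψ⟩ = Σ_{x,y} |⟨φ, S⁺_x S⁻_y φ⟩| ≥ Σ_{x,y} ⟨φ, S⁺_x S⁻_y φ⟩ = ⟨φ, S⁺ S⁻ φ⟩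
= ⟨φ, (S² - (S^z)² + S^z) φ⟩ = S₀(S₀+1) ‖φ‖² = S₀(S₀+1) ‖ψ‖²`.

## References

* S.-Q. Shen, Z.-M. Qiu, *Exact demonstration of off-diagonal long-range order in the ground state
  of a Hubbard model*, Phys. Rev. Lett. 71 (1993) 4238–4240 (paywalled, `acq-01355`; statement and
  proof structure taken from Goto–Koma–Yoshida §1, §4–§5). [ShenQiu1993]
* Y. Goto, T. Koma, H. Yoshida, *Superconductivity and low energy excitations in an attractive
  Hubbard model*, arXiv:2509.19780, Phys. Scr. 101 (2026) 325218 — §2.1 (Shiba transformation (2.3)),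
  §3 ((3.14), (3.15)), §4 ((4.19)–(4.21)), §5 ((5.4)–(5.9), Theorem 5.1). [GotoKomaYoshida2025]
* E. H. Lieb, *Two theorems on the Hubbard model*, Phys. Rev. Lett. 62 (1989) 1201 — Theorems 1, 2
  and the hole–particle transformation of the proof of Theorem 2. [LiebPRL1989]
* S.-Q. Shen, Z.-M. Qiu, G.-S. Tian, Phys. Rev. Lett. 72 (1994) 1280 (sign rule). [ShenQiuTian1994]
* K. Kubo, T. Kishi, Phys. Rev. B 41 (1990) 4866, proof of Theorem 2 (the gauged transformation).
  [KuboKishi1990]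
-/

noncomputable section

namespace Literature.MathematicalPhysics.QuantumLattice

open Matrix Finset LiebThm1 LiebTwo FermionSpinMoment HubbardWave0
open scoped ComplexOrder

variable {Λ : Type*} [LinearOrder Λ] [Fintype Λ]

/-! ### The gauged Shiba transformation attached to a bipartition -/

section Shiba

/-- The orbital phases of the gauged Shiba map: `g(x↓) = ε_x = stagSign A x`, `g(x↑) = 1`.
Goto–Koma–Yoshida (2.2)–(2.3); Kubo–Kishi, proof of Theorem 2. [cite: GotoKomaYoshida2025, eq. (2.3)] -/
def shibaGauge (A : Finset Λ) : Orb Λ → ℂ :=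
  fun i => if (ofLex i).2 = 1 then stagSign A (ofLex i).1 else 1

/-- **The gauged Shiba transformation** `S = orbitalPhase g · W_{D↓}`: `c_{x↓} ↦ ε_x c†_{x↓}`,
`c_{x↑} ↦ c_{x↑}`. [cite: GotoKomaYoshida2025, eq. (2.3)] [cite: LiebPRL1989, proof of Theorem 2] -/
def shiba (A : Finset Λ) : Matrix (Finset (Orb Λ)) (Finset (Orb Λ)) ℂ :=
  orbitalPhase (shibaGauge A) * partialParticleHole (spinDownOrbitals : Finset (Orb Λ))

omit [Fintype Λ] in
/-- `g(x↑) = 1`. [cite: GotoKomaYoshida2025, eq. (2.3)] -/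
theorem shibaGauge_up (A : Finset Λ) (x : Λ) : shibaGauge A (orb x 0) = 1 := by
  simp [shibaGauge, orb]

omit [Fintype Λ] in
/-- `g(x↓) = ε_x`. [cite: GotoKomaYoshida2025, eq. (2.3)] -/
theorem shibaGauge_down (A : Finset Λ) (x : Λ) : shibaGauge A (orb x 1) = stagSign A x := by
  simp [shibaGauge, orb]

omit [Fintype Λ] in
/-- `ε_x^* = ε_x` (the sublattice sign is real). [cite: LiebPRL1989, Theorem 2] -/
theorem star_stagSign (A : Finset Λ) (x : Λ) : star (stagSign A x) = stagSign A x := by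
  unfold stagSign; split_ifs <;> simp

omit [Fintype Λ] in
/-- `|g_i| = 1`. [cite: GotoKomaYoshida2025, eq. (2.3)] -/
theorem norm_shibaGauge (A : Finset Λ) (i : Orb Λ) : ‖shibaGauge A i‖ = 1 := by
  unfold shibaGauge
  split_ifs
  · exact norm_stagSign A _
  · simp

/-- Across a bond of a bipartite graph the sublattice signs are opposite: `ε_x ε_y = -1`.
[cite: LiebPRL1989, Theorem 2] -/
theorem stagSign_mul_stagSign_of_adj {G : SimpleGraph Λ} (A : Finset Λ)
    (hA : ∀ x y : Λ, G.Adj x y → (x ∈ A ↔ y ∉ A)) {x y : Λ} (hxy : G.Adj x y) :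
    stagSign A x * stagSign A y = -1 := by
  by_cases hx : x ∈ A
  · have hy : y ∈ Aᶜ := Finset.mem_compl.2 ((hA x y hxy).1 hx)
    rw [stagSign_of_mem hx, stagSign_of_mem_compl hy, one_mul]
  · have hy : y ∈ A := (hA y x hxy.symm).mpr hx
    rw [stagSign_of_mem_compl (Finset.mem_compl.2 hx), stagSign_of_mem hy]; norm_num

/-- The bond condition of `shibaKK_conj_hamiltonian`: `g(x↓) g(y↓)^* = -1` on every bond.
[cite: KuboKishi1990, proof of Theorem 2] -/
theorem shibaGauge_bond {G : SimpleGraph Λ} (A : Finset Λ)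
    (hA : ∀ x y : Λ, G.Adj x y → (x ∈ A ↔ y ∉ A)) {x y : Λ} (hxy : G.Adj x y) :
    shibaGauge A (orb x 1) * star (shibaGauge A (orb y 1)) = -1 := by
  rw [shibaGauge_down, shibaGauge_down, star_stagSign, stagSign_mul_stagSign_of_adj A hA hxy]

/-- `S` is unitary: `Sᴴ S = 1`. [cite: GotoKomaYoshida2025, eq. (2.3)] -/
theorem shiba_conjTranspose_mul_self (A : Finset Λ) : (shiba A)ᴴ * shiba A = 1 :=
  (mul_mem (orbitalPhase_mem_unitary (norm_shibaGauge A))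
    (partialParticleHole_mem_unitaryGroup (spinDownOrbitals : Finset (Orb Λ)))).1

/-- `S` is unitary: `S Sᴴ = 1`. [cite: GotoKomaYoshida2025, eq. (2.3)] -/
theorem shiba_mul_conjTranspose (A : Finset Λ) : shiba A * (shiba A)ᴴ = 1 :=
  (mul_mem (orbitalPhase_mem_unitary (norm_shibaGauge A))
    (partialParticleHole_mem_unitaryGroup (spinDownOrbitals : Finset (Orb Λ)))).2

/-- Conjugation by `S` is multiplicative. [folklore] -/
private theorem shiba_conj_mul (A : Finset Λ) (X Y : Matrix (Finset (Orb Λ)) (Finset (Orb Λ)) ℂ) :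
    shiba A * (X * Y) * (shiba A)ᴴ = (shiba A * X * (shiba A)ᴴ) * (shiba A * Y * (shiba A)ᴴ) := by
  calc shiba A * (X * Y) * (shiba A)ᴴ
      = shiba A * X * ((shiba A)ᴴ * shiba A) * Y * (shiba A)ᴴ := by
        rw [shiba_conjTranspose_mul_self, Matrix.mul_one, Matrix.mul_assoc (shiba A) X Y]
    _ = _ := by simp only [Matrix.mul_assoc]

/-- Conjugation by `S` factors through the two layers. [folklore] -/
private theorem shiba_conj_eq (A : Finset Λ) (X : Matrix (Finset (Orb Λ)) (Finset (Orb Λ)) ℂ) :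
    shiba A * X * (shiba A)ᴴ =
      orbitalPhase (shibaGauge A) *
        (partialParticleHole (spinDownOrbitals : Finset (Orb Λ)) * X *
          (partialParticleHole (spinDownOrbitals : Finset (Orb Λ)))ᴴ) *
        (orbitalPhase (shibaGauge A))ᴴ := by
  rw [shiba, conjTranspose_mul]; simp only [Matrix.mul_assoc]

/-- `S c†_{x↑} Sᴴ = c†_{x↑}`. [cite: GotoKomaYoshida2025, eq. (2.3)] -/
theorem shiba_conj_creation_up (A : Finset Λ) (x : Λ) :
    shiba A * creation (orb x 0) * (shiba A)ᴴ = creation (orb x 0) := by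
  have h0 : orb x 0 ∉ (spinDownOrbitals : Finset (Orb Λ)) := by
    rw [orb_mem_spinDownOrbitals_iff]; exact Fin.zero_ne_one
  rw [shiba_conj_eq, partialParticleHole_conj_creation_of_not_mem h0,
    orbitalPhase_conj_creation (norm_shibaGauge A), shibaGauge_up, one_smul]

/-- `S c_{x↑} Sᴴ = c_{x↑}`. [cite: GotoKomaYoshida2025, eq. (2.3)] -/
theorem shiba_conj_annihilation_up (A : Finset Λ) (x : Λ) :
    shiba A * annihilation (orb x 0) * (shiba A)ᴴ = annihilation (orb x 0) := by
  have h0 : orb x 0 ∉ (spinDownOrbitals : Finset (Orb Λ)) := by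
    rw [orb_mem_spinDownOrbitals_iff]; exact Fin.zero_ne_one
  rw [shiba_conj_eq, partialParticleHole_conj_annihilation_of_not_mem h0,
    orbitalPhase_conj_annihilation (norm_shibaGauge A), shibaGauge_up, star_one, one_smul]

/-- `S c_{x↓} Sᴴ = ε_x c†_{x↓}`. [cite: GotoKomaYoshida2025, eq. (2.3)] -/
theorem shiba_conj_annihilation_down (A : Finset Λ) (x : Λ) :
    shiba A * annihilation (orb x 1) * (shiba A)ᴴ = stagSign A x • creation (orb x 1) := by
  have h1 : orb x 1 ∈ (spinDownOrbitals : Finset (Orb Λ)) := by rw [orb_mem_spinDownOrbitals_iff]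
  rw [shiba_conj_eq, partialParticleHole_conj_annihilation_of_mem h1,
    orbitalPhase_conj_creation (norm_shibaGauge A), shibaGauge_down]

/-- `S c†_{x↓} Sᴴ = ε_x c_{x↓}`. [cite: GotoKomaYoshida2025, eq. (2.3)] -/
theorem shiba_conj_creation_down (A : Finset Λ) (x : Λ) :
    shiba A * creation (orb x 1) * (shiba A)ᴴ = stagSign A x • annihilation (orb x 1) := by
  have h1 : orb x 1 ∈ (spinDownOrbitals : Finset (Orb Λ)) := by rw [orb_mem_spinDownOrbitals_iff]
  rw [shiba_conj_eq, partialParticleHole_conj_creation_of_mem h1,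
    orbitalPhase_conj_annihilation (norm_shibaGauge A), shibaGauge_down, star_stagSign]

/-- **The Shiba map sends the transverse spin flip to the staggered pair hopping**:
`S (S⁺_x S⁻_y) Sᴴ = ε_x ε_y · Δ†_x Δ_y`, `Δ†_x = c†_{x↑} c†_{x↓}`, `Δ_y = c_{y↓} c_{y↑}`
(Goto–Koma–Yoshida (3.15), read backwards). [cite: GotoKomaYoshida2025, eq. (3.15)] -/
theorem shiba_conj_spinPlus_mul_spinMinus (A : Finset Λ) (x y : Λ) :
    shiba A * (fermionSpinPlus x * fermionSpinMinus y) * (shiba A)ᴴ =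
      (stagSign A x * stagSign A y) •
        ((creation (orb x 0) * creation (orb x 1)) * (annihilation (orb y 1) * annihilation (orb y 0))) := by
  rw [fermionSpinPlus_def, fermionSpinMinus_def, shiba_conj_mul, shiba_conj_mul, shiba_conj_mul,
    shiba_conj_creation_up, shiba_conj_annihilation_down, shiba_conj_creation_down,
    shiba_conj_annihilation_up, Matrix.mul_smul, Matrix.smul_mul, Matrix.smul_mul, Matrix.mul_smul,
    smul_smul]

/-- **The pair correlation operator as a Shiba image**: `Δ†_x Δ_y = ε_x ε_y · S (S⁺_x S⁻_y) Sᴴ`.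
[cite: GotoKomaYoshida2025, eq. (3.15)] -/
theorem pairCorrelation_eq_shiba_conj (A : Finset Λ) (x y : Λ) :
    (creation (orb x 0) * creation (orb x 1)) * (annihilation (orb y 1) * annihilation (orb y 0)) =
      (stagSign A x * stagSign A y) • (shiba A * (fermionSpinPlus x * fermionSpinMinus y) * (shiba A)ᴴ) := by
  rw [shiba_conj_spinPlus_mul_spinMinus, smul_smul,
    show stagSign A x * stagSign A y * (stagSign A x * stagSign A y) =
      (stagSign A x * stagSign A x) * (stagSign A y * stagSign A y) by ring,
    stagSign_mul_self, stagSign_mul_self, one_mul, one_smul]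

/-- `S H(t,U) Sᴴ = H(t,-U) + U N↑` for the gauged Shiba map of a bipartition of `G`
(the tree's `shibaKK_conj_hamiltonian`). [cite: KuboKishi1990, proof of Theorem 2] [cite: GotoKomaYoshida2025, eqs. (2.5)–(2.6)] -/
theorem shiba_conj_hamiltonian (G : SimpleGraph Λ) [DecidableRel G.Adj] (A : Finset Λ)
    (hA : ∀ x y : Λ, G.Adj x y → (x ∈ A ↔ y ∉ A)) (t U : ℝ) :
    shiba A * hamiltonian G t U * (shiba A)ᴴ = hamiltonian G t (-U) + (U : ℂ) • ∑ x : Λ, numberOp x 0 :=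
  shibaKK_conj_hamiltonian G (norm_shibaGauge A) (shibaGauge_up A) (fun _ _ h => shibaGauge_bond A hA h) t U

/-- Matrix elements transform by `⟨Sᴴ ψ, X Sᴴ ψ⟩ = ⟨ψ, (S X Sᴴ) ψ⟩`. [folklore] -/
private theorem star_shibaH_dotProduct (A : Finset Λ) (X : Matrix (Finset (Orb Λ)) (Finset (Orb Λ)) ℂ)
    (ψ : Fock (Orb Λ)) :
    star ((shiba A)ᴴ *ᵥ ψ) ⬝ᵥ (X *ᵥ ((shiba A)ᴴ *ᵥ ψ)) = star ψ ⬝ᵥ ((shiba A * X * (shiba A)ᴴ) *ᵥ ψ) := by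
  rw [star_mulVec, conjTranspose_conjTranspose, ← dotProduct_mulVec, mulVec_mulVec, mulVec_mulVec]

/-- `‖Sᴴ ψ‖² = ‖ψ‖²`. [folklore] -/
private theorem star_shibaH_dotProduct_self (A : Finset Λ) (ψ : Fock (Orb Λ)) :
    star ((shiba A)ᴴ *ᵥ ψ) ⬝ᵥ ((shiba A)ᴴ *ᵥ ψ) = star ψ ⬝ᵥ ψ := by
  have h := star_shibaH_dotProduct A 1 ψ
  rwa [one_mulVec, Matrix.mul_one, shiba_mul_conjTranspose, one_mulVec] at h

end Shiba

/-! ### Sector bookkeeping for the Shiba map -/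

section Sectors

/-- `IsInSector a b v ↔ P_{a,b} v = v`. [cite: LiebPRL1989, proof of Theorem 1] -/
theorem isInSector_iff_spinSectorProj_mulVec (a b : ℕ) (v : Fock (Orb Λ)) :
    IsInSector a b v ↔ spinSectorProj a b *ᵥ v = v := by
  constructor
  · intro h; rw [spinSectorProj_mulVec, sectorProj_eq_self h]
  · intro h; rw [← h, spinSectorProj_mulVec]; exact isInSector_sectorProj a b v

/-- **The Shiba map preserves the central sector**: `S P_{n,n} Sᴴ = P_{n,n}` when `|Λ| = 2n`.
[cite: GotoKomaYoshida2025, eq. (4.19)–(4.21)] [cite: LiebPRL1989, proof of Theorem 2] -/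
theorem shiba_conj_spinSectorProj_central (A : Finset Λ) {n : ℕ} (hΛ : Fintype.card Λ = n + n) :
    shiba A * spinSectorProj n n * (shiba A)ᴴ = spinSectorProj n n := by
  have hn : n ≤ Fintype.card Λ := by rw [hΛ]; omega
  rw [shiba, shibaKK_conj_spinSectorProj (norm_shibaGauge A) hn, hΛ, Nat.add_sub_cancel]

/-- `P_{n,n} Sᴴ = Sᴴ P_{n,n}` (`|Λ| = 2n`). [cite: GotoKomaYoshida2025, eq. (4.19)–(4.21)] -/
theorem spinSectorProj_mul_shibaH (A : Finset Λ) {n : ℕ} (hΛ : Fintype.card Λ = n + n) :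
    spinSectorProj n n * (shiba A)ᴴ = (shiba A)ᴴ * spinSectorProj n n := by
  calc spinSectorProj n n * (shiba A)ᴴ
      = ((shiba A)ᴴ * shiba A) * spinSectorProj n n * (shiba A)ᴴ := by
        rw [shiba_conjTranspose_mul_self, Matrix.one_mul]
    _ = (shiba A)ᴴ * (shiba A * spinSectorProj n n * (shiba A)ᴴ) := by simp only [Matrix.mul_assoc]
    _ = (shiba A)ᴴ * spinSectorProj n n := by rw [shiba_conj_spinSectorProj_central A hΛ]

/-- `P_{n,n} S = S P_{n,n}` (`|Λ| = 2n`). [cite: GotoKomaYoshida2025, eq. (4.19)–(4.21)] -/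
theorem spinSectorProj_mul_shiba (A : Finset Λ) {n : ℕ} (hΛ : Fintype.card Λ = n + n) :
    spinSectorProj n n * shiba A = shiba A * spinSectorProj n n := by
  calc spinSectorProj n n * shiba A
      = (shiba A * spinSectorProj n n * (shiba A)ᴴ) * shiba A := by
        rw [shiba_conj_spinSectorProj_central A hΛ]
    _ = shiba A * spinSectorProj n n * ((shiba A)ᴴ * shiba A) := by simp only [Matrix.mul_assoc]
    _ = shiba A * spinSectorProj n n := by rw [shiba_conjTranspose_mul_self, Matrix.mul_one]

/-- `Sᴴ` maps the central sector into itself. [cite: GotoKomaYoshida2025, eq. (4.19)–(4.21)] -/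
theorem isInSector_shibaH_mulVec (A : Finset Λ) {n : ℕ} (hΛ : Fintype.card Λ = n + n)
    {ψ : Fock (Orb Λ)} (hψ : IsInSector n n ψ) : IsInSector n n ((shiba A)ᴴ *ᵥ ψ) := by
  rw [isInSector_iff_spinSectorProj_mulVec] at hψ ⊢
  rw [mulVec_mulVec, spinSectorProj_mul_shibaH A hΛ, ← mulVec_mulVec, hψ]

/-- `S` maps the central sector into itself. [cite: GotoKomaYoshida2025, eq. (4.19)–(4.21)] -/
theorem isInSector_shiba_mulVec (A : Finset Λ) {n : ℕ} (hΛ : Fintype.card Λ = n + n)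
    {ψ : Fock (Orb Λ)} (hψ : IsInSector n n ψ) : IsInSector n n (shiba A *ᵥ ψ) := by
  rw [isInSector_iff_spinSectorProj_mulVec] at hψ ⊢
  rw [mulVec_mulVec, spinSectorProj_mul_shiba A hΛ, ← mulVec_mulVec, hψ]

/-- On the coordinate sector `(a, b)` the up number acts as `a`: `N↑ v = a v`. [cite: LiebPRL1989, proof of Theorem 2] -/
theorem sum_numberOp_up_mulVec_of_isInSector {a b : ℕ} {v : Fock (Orb Λ)} (hv : IsInSector a b v) :
    (∑ x : Λ, numberOp x 0) *ᵥ v = (a : ℂ) • v := by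
  rw [sum_numberOp_zero_eq_diagonal]
  funext s
  rw [mulVec_diagonal, Pi.smul_apply, smul_eq_mul]
  by_cases hs : (upPart s).card = a ∧ (downPart s).card = b
  · rw [hs.1]
  · rw [hv s hs, mul_zero, mul_zero]

/-- The sector energy is a lower bound for the Rayleigh quotient of every unit vector of the
sector (variational principle, private copy of `Matrix.minEnergyOn_le_rayleigh_of_mem`). [folklore] -/
private theorem minEnergyOn_le_rayleigh' {H : Matrix (Finset (Orb Λ)) (Finset (Orb Λ)) ℂ}
    (hH : H.IsHermitian) (K : Submodule ℂ (Fock (Orb Λ))) {ψ : Fock (Orb Λ)} (hψ : ψ ∈ K)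
    (h1 : star ψ ⬝ᵥ ψ = 1) : H.minEnergyOn K ≤ (star ψ ⬝ᵥ H *ᵥ ψ).re := by
  refine csInf_le ⟨H.groundEnergy, ?_⟩ ⟨ψ, hψ, h1, rfl⟩
  rintro E ⟨φ, -, hφ1, rfl⟩
  exact Matrix.groundEnergy_le_rayleigh_holds hH φ hφ1

end Sectors

/-! ### The attractive half-filled ground state and its repulsive image -/

section Attractive

variable {G : SimpleGraph Λ} [DecidableRel G.Adj]

/-- **Lieb's Theorem 1 at half filling**: every ground state of the attractive model with
`N = |Λ|` (even) particles is a singlet, hence `S^z ψ = 0` and `ψ` lies in the central coordinate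
sector `(n, n)`, `|Λ| = 2n`. [cite: LiebPRL1989, Theorem 1] [cite: GotoKomaYoshida2025, §4] -/
theorem attractive_groundState_isInSector (hG : G.Connected) {n : ℕ} (hΛ : Fintype.card Λ = n + n)
    {t U : ℝ} (ht : t ≠ 0) (hU : U < 0) {ψ : Fock (Orb Λ)}
    (hψ : IsGroundState (hamiltonian G t U) (Fintype.card Λ) ψ) :
    HubbardWave0.spinZ *ᵥ ψ = 0 ∧ IsInSector n n ψ := by
  have hS : spinSq *ᵥ ψ = 0 :=
    (lieb_attractive_holds G hG t U ht hU (Fintype.card Λ) ⟨n, hΛ⟩ (by omega)).2 ψ hψ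
  obtain ⟨-, -, hZ⟩ := spin_mulVec_eq_zero_of_spinSq_mulVec_eq_zero hS
  exact ⟨hZ, isInSector_of_spinZ_zero hΛ hψ.1 hZ⟩

/-- **The repulsive image of the attractive ground state is THE central-sector ground state of
`H(t, -U)`.** For a half-filled ground state `ψ` of `H(t, U)`, `U < 0`, the vector `φ = Sᴴ ψ`
lies in the sector `(n, n)`, is non-zero, and `H(t,-U) φ = E(n,n) φ` with `E(n, n)` the sector
energy of the repulsive model (`= E₀(U) - U n`). [cite: GotoKomaYoshida2025, §4 and eq. (5.3)]
[cite: LiebPRL1989, Theorems 1 and 2] -/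
theorem shibaH_groundState_is_sector_groundState (hG : G.Connected) (A : Finset Λ)
    (hA : ∀ x y : Λ, G.Adj x y → (x ∈ A ↔ y ∉ A)) {n : ℕ} (hΛ : Fintype.card Λ = n + n)
    {t U : ℝ} (ht : t ≠ 0) (hU : U < 0) {ψ : Fock (Orb Λ)}
    (hψ : IsGroundState (hamiltonian G t U) (Fintype.card Λ) ψ) :
    IsInSector n n ((shiba A)ᴴ *ᵥ ψ) ∧ (shiba A)ᴴ *ᵥ ψ ≠ 0 ∧
      hamiltonian G t (-U) *ᵥ ((shiba A)ᴴ *ᵥ ψ) =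
        (((hamiltonian G t (-U)).minEnergyOn (szSector (n + n) (((n : ℝ) - n) / 2)) : ℝ) : ℂ) •
          ((shiba A)ᴴ *ᵥ ψ) := by
  classical
  obtain ⟨hZ, hsec⟩ := attractive_groundState_isInSector hG hΛ ht hU hψ
  set S := shiba A with hSdef
  set Ha := hamiltonian G t U with hHa
  set Hr := hamiltonian G t (-U) with hHr
  set Nup : Matrix (Finset (Orb Λ)) (Finset (Orb Λ)) ℂ := ∑ x : Λ, numberOp x 0 with hNup
  set Ea : ℝ := groundEnergy Ha (Fintype.card Λ) with hEa
  set K : Submodule ℂ (Fock (Orb Λ)) := szSector (n + n) (((n : ℝ) - n) / 2) with hK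
  set Er : ℝ := Hr.minEnergyOn K with hEr
  set φ := Sᴴ *ᵥ ψ with hφdef
  have hSS : Sᴴ * S = 1 := shiba_conjTranspose_mul_self A
  have hSS' : S * Sᴴ = 1 := shiba_mul_conjTranspose A
  -- `S Hr Sᴴ = Ha - U N↑` (from `S H(t,-U) Sᴴ = H(t,U) + (-U) N↑`)
  have hconj : S * Hr * Sᴴ = Ha + ((-U : ℝ) : ℂ) • Nup := by
    have h := shiba_conj_hamiltonian G A hA t (-U)
    rw [neg_neg] at h
    rw [hSdef, hHr, h, hHa, hNup]
  have hφsec : IsInSector n n φ := isInSector_shibaH_mulVec A hΛ hsec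
  have hφne : φ ≠ 0 := by
    intro h
    apply hψ.2.1
    calc ψ = (S * Sᴴ) *ᵥ ψ := by rw [hSS', one_mulVec]
      _ = 0 := by rw [← mulVec_mulVec, ← hφdef, h, mulVec_zero]
  -- `Hr φ = (Ea - U n) φ`
  have hNψ : Nup *ᵥ ψ = (n : ℂ) • ψ := sum_numberOp_up_mulVec_of_isInSector hsec
  have hSψ : S *ᵥ (Sᴴ *ᵥ ψ) = ψ := by rw [mulVec_mulVec, hSS', one_mulVec]
  have hHrφ : Hr *ᵥ φ = ((Ea - U * n : ℝ) : ℂ) • φ := by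
    have h1 : Hr = Sᴴ * (Ha + ((-U : ℝ) : ℂ) • Nup) * S := by
      rw [← hconj]
      calc Hr = (Sᴴ * S) * Hr * (Sᴴ * S) := by rw [hSS, Matrix.one_mul, Matrix.mul_one]
        _ = Sᴴ * (S * Hr * Sᴴ) * S := by simp only [Matrix.mul_assoc]
    rw [h1, hφdef, ← mulVec_mulVec, ← mulVec_mulVec, hSψ, add_mulVec, Matrix.smul_mulVec, hNψ,
      hψ.2.2, ← hEa, smul_smul, ← add_smul, mulVec_smul]
    congr 1
    push_cast; ring
  -- the two variational inequalities
  have hHr_herm : Hr.IsHermitian := hamiltonian_isHermitian G t (-U)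
  have hle : Er ≤ Ea - U * n := by
    obtain ⟨c, -, hc1⟩ := exists_smul_unit hφne
    have hmem : c • φ ∈ K := by
      rw [hK, mem_szSector_iff_isInSector]; exact hφsec.smul c
    have h := minEnergyOn_le_rayleigh' hHr_herm K hmem hc1
    rwa [mulVec_smul, hHrφ, smul_comm, dotProduct_smul, hc1, smul_eq_mul, mul_one,
      Complex.ofReal_re] at h
  have hge : Ea - U * n ≤ Er := by
    -- the repulsive sector ground state transported to the attractive side
    obtain ⟨W₀, -, hne, hH, -⟩ :=
      halfFilled_upDownSector_groundState G hG A hA ht (show 0 < -U by linarith) hΛ.symm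
    set ξ := S *ᵥ toFockN A n W₀ with hξ
    have hξsec : IsInSector n n ξ := isInSector_shiba_mulVec A hΛ (isInSector_toFockN A hΛ.symm W₀)
    have hξne : ξ ≠ 0 := by
      intro h
      apply hne
      calc toFockN A n W₀ = (Sᴴ * S) *ᵥ toFockN A n W₀ := by rw [hSS, one_mulVec]
        _ = 0 := by rw [← mulVec_mulVec, ← hξ, h, mulVec_zero]
    have hHaξ : Ha *ᵥ ξ = ((Er + U * n : ℝ) : ℂ) • ξ := by
      have h1 : Ha = S * Hr * Sᴴ - ((-U : ℝ) : ℂ) • Nup := by rw [hconj, add_sub_cancel_right]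
      have hNξ : Nup *ᵥ ξ = (n : ℂ) • ξ := sum_numberOp_up_mulVec_of_isInSector hξsec
      have hSHΦ : Sᴴ *ᵥ (S *ᵥ toFockN A n W₀) = toFockN A n W₀ := by
        rw [mulVec_mulVec, hSS, one_mulVec]
      rw [← hHr, ← hK, ← hEr] at hH
      rw [h1, sub_mulVec, Matrix.smul_mulVec, hNξ, hξ, ← mulVec_mulVec, ← mulVec_mulVec, hSHΦ, hH,
        mulVec_smul, smul_smul, ← sub_smul]
      congr 1
      push_cast; ring
    obtain ⟨c, -, hc1⟩ := exists_smul_unit hξne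
    have hN : IsNParticle (Fintype.card Λ) (c • ξ) := by
      have h := (hξsec.smul c).isNParticle; rwa [← hΛ] at h
    have h := groundEnergy_le_re_expect Ha hN hc1
    rw [expect, mulVec_smul, hHaξ, smul_comm, dotProduct_smul, hc1, smul_eq_mul, mul_one,
      Complex.ofReal_re] at h
    rw [hEa]; linarith
  have hE : Er = Ea - U * n := le_antisymm hle hge
  exact ⟨hφsec, hφne, by rw [hHrφ, ← hE]⟩

/-- **The repulsive image is a member of Lieb's ground multiplet**: `φ = Sᴴ ψ` is a half-filled
ground state of `H(t, -U)` with `S^z φ = 0`, hence `S² φ = S₀(S₀+1) φ`, `S₀ = liebSpin A`.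
[cite: GotoKomaYoshida2025, §4] [cite: LiebPRL1989, Theorem 2] -/
theorem shibaH_groundState_isGroundState (hG : G.Connected) (A : Finset Λ)
    (hA : ∀ x y : Λ, G.Adj x y → (x ∈ A ↔ y ∉ A)) {n : ℕ} (hΛ : Fintype.card Λ = n + n)
    {t U : ℝ} (ht : t ≠ 0) (hU : U < 0) {ψ : Fock (Orb Λ)}
    (hψ : IsGroundState (hamiltonian G t U) (Fintype.card Λ) ψ) :
    IsGroundState (hamiltonian G t (-U)) (Fintype.card Λ) ((shiba A)ᴴ *ᵥ ψ) ∧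
      HubbardWave0.spinZ *ᵥ ((shiba A)ᴴ *ᵥ ψ) = 0 ∧
      spinSq *ᵥ ((shiba A)ᴴ *ᵥ ψ) = ((liebSpin A * (liebSpin A + 1) : ℝ) : ℂ) • ((shiba A)ᴴ *ᵥ ψ) := by
  obtain ⟨hsec, hne, hH⟩ := shibaH_groundState_is_sector_groundState hG A hA hΛ ht hU hψ
  have hle : n ≤ Fintype.card Λ := by rw [hΛ]; omega
  have hE : (hamiltonian G t (-U)).minEnergyOn (szSector (n + n) (((n : ℝ) - n) / 2)) =
      groundEnergyAt G t (-U) (Fintype.card Λ) := by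
    rw [sub_self, zero_div, ← two_mul, ← groundEnergyAt_eq_minEnergyOn_szSector G t (-U) hle,
      two_mul, ← hΛ]
  have hN : IsNParticle (Fintype.card Λ) ((shiba A)ᴴ *ᵥ ψ) := by
    have h := hsec.isNParticle; rwa [← hΛ] at h
  have hgs : IsGroundState (hamiltonian G t (-U)) (Fintype.card Λ) ((shiba A)ᴴ *ᵥ ψ) :=
    ⟨hN, hne, by rw [hH, hE]; rfl⟩
  refine ⟨hgs, ?_, spinSq_mulVec_of_isGroundState hG A hA ⟨n, hΛ⟩ ht (by linarith) hgs⟩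
  rw [spinZ_mulVec_of_isInSector hsec, sub_self, mul_zero, zero_smul]

/-! ### Positivity of the pair correlation and Shen–Qiu's floor -/

/-- **The pair correlation of the attractive ground state is the staggered transverse spin
correlation of its repulsive image**: `⟨ψ, Δ†_x Δ_y ψ⟩ = ε_x ε_y ⟨φ, S⁺_x S⁻_y φ⟩`, `φ = Sᴴ ψ`.
[cite: GotoKomaYoshida2025, eqs. (3.15) and (5.4)] -/
theorem expect_pairCorrelation_eq (A : Finset Λ) (ψ : Fock (Orb Λ)) (x y : Λ) :
    star ψ ⬝ᵥ (((creation (orb x 0) * creation (orb x 1)) *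
        (annihilation (orb y 1) * annihilation (orb y 0))) *ᵥ ψ) =
      stagSign A x * stagSign A y *
        (star ((shiba A)ᴴ *ᵥ ψ) ⬝ᵥ ((fermionSpinPlus x * fermionSpinMinus y) *ᵥ ((shiba A)ᴴ *ᵥ ψ))) := by
  rw [pairCorrelation_eq_shiba_conj A, Matrix.smul_mulVec, dotProduct_smul, smul_eq_mul,
    star_shibaH_dotProduct]

/-- **Positivity of the superconducting correlation** (Goto–Koma–Yoshida (3.14)/(5.5), canonical
form): for every half-filled ground state `ψ` of the attractive Hubbard model on a connected
bipartite graph, `⟨ψ, c†_{x↑} c†_{x↓} c_{y↓} c_{y↑} ψ⟩ ≥ 0` for all sites `x, y`.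
[cite: GotoKomaYoshida2025, eqs. (3.14) and (5.5)] [cite: ShenQiu1993, Theorem] -/
theorem expect_pair_correlation_nonneg (hG : G.Connected) (A : Finset Λ)
    (hA : ∀ x y : Λ, G.Adj x y → (x ∈ A ↔ y ∉ A)) (hΛ : Even (Fintype.card Λ))
    {t U : ℝ} (ht : t ≠ 0) (hU : U < 0) {ψ : Fock (Orb Λ)}
    (hψ : IsGroundState (hamiltonian G t U) (Fintype.card Λ) ψ) (x y : Λ) :
    0 ≤ star ψ ⬝ᵥ (((creation (orb x 0) * creation (orb x 1)) *
        (annihilation (orb y 1) * annihilation (orb y 0))) *ᵥ ψ) := by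
  obtain ⟨n, hn⟩ := hΛ
  obtain ⟨hsec, -, hH⟩ := shibaH_groundState_is_sector_groundState hG A hA hn ht hU hψ
  rw [expect_pairCorrelation_eq A]
  exact sector_sign_rule hG A hA ht (show 0 < -U by linarith) hn.symm hsec hH x y

/-- The transverse structure factor of the repulsive image: `Σ_{x,y} ⟨φ, S⁺_x S⁻_y φ⟩ = ⟨φ, S⁺S⁻ φ⟩
= S₀(S₀+1) ‖φ‖²` (`S⁺S⁻ = S² - (S^z)² + S^z`, `S^z φ = 0`). [cite: GotoKomaYoshida2025, eqs. (5.6)–(5.9)] -/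
theorem expect_spinPlus_mul_spinMinus_shibaH (hG : G.Connected) (A : Finset Λ)
    (hA : ∀ x y : Λ, G.Adj x y → (x ∈ A ↔ y ∉ A)) {n : ℕ} (hΛ : Fintype.card Λ = n + n)
    {t U : ℝ} (ht : t ≠ 0) (hU : U < 0) {ψ : Fock (Orb Λ)}
    (hψ : IsGroundState (hamiltonian G t U) (Fintype.card Λ) ψ) :
    star ((shiba A)ᴴ *ᵥ ψ) ⬝ᵥ ((spinPlus * spinMinus) *ᵥ ((shiba A)ᴴ *ᵥ ψ)) =
      ((liebSpin A * (liebSpin A + 1) : ℝ) : ℂ) * (star ψ ⬝ᵥ ψ) := by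
  obtain ⟨-, hZ, hS2⟩ := shibaH_groundState_isGroundState hG A hA hΛ ht hU hψ
  have hPM : (spinPlus * spinMinus : Matrix (Finset (Orb Λ)) (Finset (Orb Λ)) ℂ) =
      spinSq - HubbardWave0.spinZ * HubbardWave0.spinZ + HubbardWave0.spinZ := by
    have h := isSu2Triple_spin (Λ := Λ) |>.su2Casimir_eq'
    rw [su2Casimir_spin_eq_spinSq] at h
    rw [h]; abel
  rw [hPM, add_mulVec, sub_mulVec, ← mulVec_mulVec, hZ, mulVec_zero, sub_zero, add_zero, hS2,
    dotProduct_smul, smul_eq_mul, star_shibaH_dotProduct_self]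

/-- **Shen–Qiu's off-diagonal long-range order in the attractive Hubbard ground state (kernel
form).** On a connected bipartite graph with colour class `A` (any `|A|, |B|`, `|Λ|` even),
`t ≠ 0`, `U < 0`: every half-filled ground state `ψ` of `H(t, U)` satisfies
`S₀(S₀+1) ‖ψ‖² ≤ Re ⟨ψ, (Σ_x c†_{x↑} c†_{x↓})(Σ_y c_{y↓} c_{y↑}) ψ⟩`, `S₀ = ||A| - |B||/2` — the
zero-momentum `s`-wave pair structure factor has the floor `S₀(S₀+1)`, of order `|Λ|²` on Lieb
lattices (Goto–Koma–Yoshida Theorem 5.1 / eq. (5.9) in the canonical ensemble, where the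
multiplet-averaging factor `2/3`, resp. `1/3`, is absent). [cite: ShenQiu1993, Theorem]
[cite: GotoKomaYoshida2025, Theorem 5.1 and eq. (5.9)] -/
theorem liebSpin_le_re_expect_pairSum (hG : G.Connected) (A : Finset Λ)
    (hA : ∀ x y : Λ, G.Adj x y → (x ∈ A ↔ y ∉ A)) (hΛ : Even (Fintype.card Λ))
    {t U : ℝ} (ht : t ≠ 0) (hU : U < 0) {ψ : Fock (Orb Λ)}
    (hψ : IsGroundState (hamiltonian G t U) (Fintype.card Λ) ψ) :
    liebSpin A * (liebSpin A + 1) * (star ψ ⬝ᵥ ψ).re ≤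
      (star ψ ⬝ᵥ (((∑ x : Λ, creation (orb x 0) * creation (orb x 1)) *
        (∑ y : Λ, annihilation (orb y 1) * annihilation (orb y 0))) *ᵥ ψ)).re := by
  classical
  obtain ⟨n, hn⟩ := hΛ
  obtain ⟨hsec, -, hH⟩ := shibaH_groundState_is_sector_groundState hG A hA hn ht hU hψ
  set φ := (shiba A)ᴴ *ᵥ ψ with hφ
  -- termwise: `Re ⟨ψ, Δ†_x Δ_y ψ⟩ = ε_x ε_y Re ⟨φ, S⁺_x S⁻_y φ⟩ ≥ Re ⟨φ, S⁺_x S⁻_y φ⟩`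
  have hterm : ∀ x y : Λ,
      (star φ ⬝ᵥ ((fermionSpinPlus x * fermionSpinMinus y) *ᵥ φ)).re ≤
        (star ψ ⬝ᵥ (((creation (orb x 0) * creation (orb x 1)) *
          (annihilation (orb y 1) * annihilation (orb y 0))) *ᵥ ψ)).re := by
    intro x y
    have hsign := sector_sign_rule hG A hA ht (show 0 < -U by linarith) hn.symm hsec hH x y
    have hre := (Complex.nonneg_iff.mp hsign).1
    rw [expect_pairCorrelation_eq A, ← hφ]
    set z := star φ ⬝ᵥ ((fermionSpinPlus x * fermionSpinMinus y) *ᵥ φ)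
    have hε : stagSign A x * stagSign A y = 1 ∨ stagSign A x * stagSign A y = -1 := by
      unfold stagSign; split_ifs <;> norm_num
    rcases hε with h | h
    · simp only [h, one_mul, le_refl]
    · rw [h, neg_one_mul, Complex.neg_re] at hre ⊢
      linarith
  have hsum : (star φ ⬝ᵥ ((spinPlus * spinMinus) *ᵥ φ)).re =
      ∑ x, ∑ y, (star φ ⬝ᵥ ((fermionSpinPlus x * fermionSpinMinus y) *ᵥ φ)).re := by
    rw [← sum_fermionSpinPlus, ← sum_fermionSpinMinus, Finset.sum_mul_sum, Matrix.sum_mulVec,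
      dotProduct_sum, Complex.re_sum]
    refine Finset.sum_congr rfl fun x _ => ?_
    rw [Matrix.sum_mulVec, dotProduct_sum, Complex.re_sum]
  have hlhs : liebSpin A * (liebSpin A + 1) * (star ψ ⬝ᵥ ψ).re =
      (star φ ⬝ᵥ ((spinPlus * spinMinus) *ᵥ φ)).re := by
    rw [hφ, expect_spinPlus_mul_spinMinus_shibaH hG A hA hn ht hU hψ, Complex.re_ofReal_mul]
  rw [hlhs, hsum, Finset.sum_mul_sum, Matrix.sum_mulVec, dotProduct_sum, Complex.re_sum]
  refine Finset.sum_le_sum fun x _ => ?_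
  rw [Matrix.sum_mulVec, dotProduct_sum, Complex.re_sum]
  exact Finset.sum_le_sum fun y _ => hterm x y

/-- **The explicit floor**: `¼(|A| - |B|)² ‖ψ‖² ≤ Re ⟨ψ, (Σ_x Δ†_x)(Σ_y Δ_y) ψ⟩` — off-diagonal
long-range order of the on-site pairs in the attractive half-filled ground state whenever
`|A| - |B| ∝ |Λ|`. [cite: ShenQiu1993, Theorem] [cite: GotoKomaYoshida2025, Theorem 5.1] -/
theorem sq_card_sub_le_re_expect_pairSum (hG : G.Connected) (A : Finset Λ)
    (hA : ∀ x y : Λ, G.Adj x y → (x ∈ A ↔ y ∉ A)) (hΛ : Even (Fintype.card Λ))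
    {t U : ℝ} (ht : t ≠ 0) (hU : U < 0) {ψ : Fock (Orb Λ)}
    (hψ : IsGroundState (hamiltonian G t U) (Fintype.card Λ) ψ) :
    ((A.card : ℝ) - (Aᶜ.card : ℝ)) ^ 2 / 4 * (star ψ ⬝ᵥ ψ).re ≤
      (star ψ ⬝ᵥ (((∑ x : Λ, creation (orb x 0) * creation (orb x 1)) *
        (∑ y : Λ, annihilation (orb y 1) * annihilation (orb y 0))) *ᵥ ψ)).re :=
  le_trans (mul_le_mul_of_nonneg_right (sq_card_sub_div_four_le_liebSpin A)
    (Complex.nonneg_iff.mp (dotProduct_star_self_nonneg ψ)).1)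
    (liebSpin_le_re_expect_pairSum hG A hA hΛ ht hU hψ)

/-- The zero-momentum pair creator is Yang's `η†` with trivial signs: `η₀† = etaRaise 1 = Σ_x c†_{x↑} c†_{x↓}`.
[cite: Yang1989, eq. (4)] -/
theorem etaRaise_one_eq_sum :
    (etaRaise (1 : Λ → ℤˣ) : Matrix (Finset (Orb Λ)) (Finset (Orb Λ)) ℂ) =
      ∑ x : Λ, creation (orb x 0) * creation (orb x 1) := by
  simp [etaRaise]

/-- `η₀ = etaLower 1 = Σ_y c_{y↓} c_{y↑}`. [cite: Yang1989, eq. (4)] -/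
theorem etaLower_one_eq_sum :
    (etaLower (1 : Λ → ℤˣ) : Matrix (Finset (Orb Λ)) (Finset (Orb Λ)) ℂ) =
      ∑ y : Λ, annihilation (orb y 1) * annihilation (orb y 0) := by
  rw [etaLower, etaRaise_one_eq_sum, Matrix.conjTranspose_sum]
  refine Finset.sum_congr rfl fun y _ => ?_
  unfold creation
  rw [conjTranspose_mul, conjTranspose_conjTranspose, conjTranspose_conjTranspose]

/-- **Shen–Qiu's ODLRO in Yang's `η` notation**: `S₀(S₀+1) ‖ψ‖² ≤ Re ⟨ψ, η₀† η₀ ψ⟩ = ‖η₀ ψ‖²`,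
`η₀ = etaLower 1` (zero-momentum on-site pair annihilator). [cite: ShenQiu1993, Theorem]
[cite: GotoKomaYoshida2025, Theorem 5.1 and eq. (5.9)] -/
theorem liebSpin_le_re_expect_eta (hG : G.Connected) (A : Finset Λ)
    (hA : ∀ x y : Λ, G.Adj x y → (x ∈ A ↔ y ∉ A)) (hΛ : Even (Fintype.card Λ))
    {t U : ℝ} (ht : t ≠ 0) (hU : U < 0) {ψ : Fock (Orb Λ)}
    (hψ : IsGroundState (hamiltonian G t U) (Fintype.card Λ) ψ) :
    liebSpin A * (liebSpin A + 1) * (star ψ ⬝ᵥ ψ).re ≤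
      (star ψ ⬝ᵥ ((etaRaise (1 : Λ → ℤˣ) * etaLower 1) *ᵥ ψ)).re := by
  rw [etaRaise_one_eq_sum, etaLower_one_eq_sum]
  exact liebSpin_le_re_expect_pairSum hG A hA hΛ ht hU hψ

/-- **Explicit `η` form**: `¼(|A| - |B|)² ‖ψ‖² ≤ Re ⟨ψ, η₀† η₀ ψ⟩`. [cite: ShenQiu1993, Theorem]
[cite: GotoKomaYoshida2025, Theorem 5.1] -/
theorem sq_card_sub_le_re_expect_eta (hG : G.Connected) (A : Finset Λ)
    (hA : ∀ x y : Λ, G.Adj x y → (x ∈ A ↔ y ∉ A)) (hΛ : Even (Fintype.card Λ))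
    {t U : ℝ} (ht : t ≠ 0) (hU : U < 0) {ψ : Fock (Orb Λ)}
    (hψ : IsGroundState (hamiltonian G t U) (Fintype.card Λ) ψ) :
    ((A.card : ℝ) - (Aᶜ.card : ℝ)) ^ 2 / 4 * (star ψ ⬝ᵥ ψ).re ≤
      (star ψ ⬝ᵥ ((etaRaise (1 : Λ → ℤˣ) * etaLower 1) *ᵥ ψ)).re := by
  rw [etaRaise_one_eq_sum, etaLower_one_eq_sum]
  exact sq_card_sub_le_re_expect_pairSum hG A hA hΛ ht hU hψ

/-- **Existence and uniqueness packaging** (Lieb's Theorem 1 + Shen–Qiu): the attractive model at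
half filling has a ground state, unique up to a scalar, and it carries the pairing floor
`¼(|A| - |B|)² ‖ψ‖² ≤ Re ⟨ψ, η₀† η₀ ψ⟩`. [cite: LiebPRL1989, Theorem 1] [cite: ShenQiu1993, Theorem] -/
theorem exists_unique_groundState_pairing_floor (hG : G.Connected) (A : Finset Λ)
    (hA : ∀ x y : Λ, G.Adj x y → (x ∈ A ↔ y ∉ A)) (hΛ : Even (Fintype.card Λ))
    {t U : ℝ} (ht : t ≠ 0) (hU : U < 0) :
    ∃ ψ : Fock (Orb Λ), IsGroundState (hamiltonian G t U) (Fintype.card Λ) ψ ∧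
      (∀ φ : Fock (Orb Λ), IsGroundState (hamiltonian G t U) (Fintype.card Λ) φ → ∃ a : ℂ, φ = a • ψ) ∧
      ((A.card : ℝ) - (Aᶜ.card : ℝ)) ^ 2 / 4 * (star ψ ⬝ᵥ ψ).re ≤
        (star ψ ⬝ᵥ ((etaRaise (1 : Λ → ℤˣ) * etaLower 1) *ᵥ ψ)).re := by
  obtain ⟨n, hn⟩ := hΛ
  -- a ground state exists: transport the repulsive central-sector ground state
  obtain ⟨W₀, -, hne, hH, -⟩ :=
    halfFilled_upDownSector_groundState G hG A hA ht (show 0 < -U by linarith) hn.symm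
  have hsec0 : IsInSector n n (toFockN A n W₀) := isInSector_toFockN A hn.symm W₀
  have hle : n ≤ Fintype.card Λ := by rw [hn]; omega
  have hE : (hamiltonian G t (-U)).minEnergyOn (szSector (n + n) (((n : ℝ) - n) / 2)) =
      groundEnergyAt G t (-U) (Fintype.card Λ) := by
    rw [sub_self, zero_div, ← two_mul, ← groundEnergyAt_eq_minEnergyOn_szSector G t (-U) hle,
      two_mul, ← hn]
  have hN0 : IsNParticle (Fintype.card Λ) (toFockN A n W₀) := by
    have h := hsec0.isNParticle; rwa [← hn] at h
  have hgs0 : IsGroundState (hamiltonian G t (-U)) (Fintype.card Λ) (toFockN A n W₀) :=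
    ⟨hN0, hne, by rw [hH, hE]; rfl⟩
  -- hence the attractive `|Λ|`-particle sector is non-empty and has a ground state
  obtain ⟨⟨ψ, hψK, hψ0, hψeq⟩, -⟩ := sector_groundState (hamiltonian G t U)
    (hamiltonian_isHermitian G t U) (fun s => s.card = Fintype.card Λ)
    ⟨pairSet univ ∅, by rw [card_pairSet, card_univ]; simp⟩
    (fun s s' hs hs' => by
      by_contra hne'
      obtain ⟨h1, h2⟩ := preservesSectors_hamiltonian G t U _ _ hne'
      apply hs
      rw [← pairSet_upPart_downPart s, card_pairSet, h1, h2, ← card_pairSet, pairSet_upPart_downPart]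
      exact hs')
    (nParticleSubmodule (ι := Orb Λ) (Fintype.card Λ)) (fun _ => Iff.rfl)
  rw [← groundEnergy_eq_minEnergyOn _ _ _ (fun _ => Iff.rfl)] at hψeq
  have hψgs : IsGroundState (hamiltonian G t U) (Fintype.card Λ) ψ := ⟨hψK, hψ0, hψeq⟩
  refine ⟨ψ, hψgs, fun φ hφ => ?_, sq_card_sub_le_re_expect_eta hG A hA ⟨n, hn⟩ ht hU hψgs⟩
  exact (lieb_attractive_holds G hG t U ht hU (Fintype.card Λ) ⟨n, hn⟩ (by omega)).1 ψ φ hψgs hφ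

end Attractive

end Literature.MathematicalPhysics.QuantumLattice
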